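import Mathlib
import HarnessLib
import Summits.Ventures.LatticeQCDFlow.Exactness.SphereLOFlowLinks

/-!
# The triangle trace for `U(1)` link phases: `Σ_i ⟪φ_a φ_b e_i, φ_c e_i⟫ = d·Re(c̄ab)` — the oriented-triangle term of Lüscher's NNLO constant `ċ₂` for the CP(N−1) action is `d·cos(flux)`

HONEST FRAMING: exact (Metropolis-corrected) sampling algorithms for lattice gauge theory;
figures of merit are autocorrelation/cost numbers at stated couplings and volumes; no
continuum-physics claim.

Venture `LatticeQCDFlow` (cell pub-lqcd), topic `Exactness`; FANOUT row 7 (`s0-cpn-null`).  NEW WORK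
of the cell over the tree's `Exactness/SphereLOFlowLinks.lean` (GEN-6: the `U(1)` link phase as the
real linear isometry `phaseRot c` of `ℝ^{2N} ≅ ℂ^N`, `cplx_phaseRot`, `inner_eq_re_sum_conj_mul`) and
`Exactness/ComplexSphereAction.lean` (row 9: `cplx`/`rvec`, `norm_rvec_sq`); nothing is cited as a
fact.  Printed counterpart, NAMED ONLY: M. Lüscher, Commun. Math. Phys. 293 (2010) 899, §4.2 (the
constants of the series); Engel–Schaefer 2011 §2 eq. (1) (the CP(N−1) action with `U(1)` link phases
`λ_{n,μ}`).

GEN-13's `SphereActionThirdMoment.lean` gave Lüscher's NNLO constant in closed form,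
`ċ₂ = (4κ³/d³)·Σ_{k,n,m} Σ_i ⟪U_kn U_nm b_i, U_km b_i⟫` (a sum over oriented triangles of the
coupling graph), and listed as follow-up (e) the evaluation of the triangle term for `U(1)` phases.
THIS FILE evaluates it:

* §1 the phase transporters compose and invert like the phases (**`phaseRot_apply_phaseRot`**,
  **`phaseRot_conj_apply_phaseRot`**, via row 9's `cplx_injective`), and **`inner_phaseRot_self`**: `⟪φ_w x, x⟫ = Re(w)·‖x‖²`;
* §2 **`sum_inner_phaseRot_orthonormalBasis`**: `Σ_i ⟪φ_w b_i, b_i⟫ = (card ι)·Re w` for every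
  orthonormal basis `b` indexed by `ι` (so `= d·Re w`, `d = 2N`), and **THE TRIANGLE TRACE**
  (**`sum_inner_phaseRot_triangle`**): `Σ_i ⟪φ_a (φ_b b_i), φ_c b_i⟫ = (card ι)·Re(c̄·a·b)` — with
  `U_kn = φ_{λ_kn}`, `U_nm = φ_{λ_nm}`, `U_km = φ_{λ_km}` and `λ_mk = λ̄_km` this is
  `d·Re(λ_mk λ_kn λ_nm) = d·cos(arg of the flux around the triangle k → n → m → k)`.

NOT CLAIMED: the assembly with `linkCoupling` on a particular graph (on the square lattices of the
rung there are no triangles at all — GEN-13 U4); anything quantitative.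
-/

noncomputable section

namespace Summit.Ventures.LatticeQCDFlow.Exactness

open Matrix WithLp Complex
open scoped RealInnerProductSpace ComplexConjugate

variable {n : Type*} [Fintype n] [DecidableEq n]

/-! ## §1 Composition, inversion, and the diagonal matrix element of a phase -/

section Phase

/-- **Phases compose**: `φ_a (φ_b x) = φ_{ab} x` (for any admissible proof that `‖ab‖ = 1`). -/
theorem phaseRot_apply_phaseRot {a b : ℂ} (ha : ‖a‖ = 1) (hb : ‖b‖ = 1) (hab : ‖a * b‖ = 1)
    (x : EuclideanSpace ℝ (n ⊕ n)) :
    phaseRot a ha (phaseRot b hb x) = phaseRot (a * b) hab x := by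
  apply cplx_injective
  rw [cplx_phaseRot, cplx_phaseRot, cplx_phaseRot, smul_smul]

/-- **The conjugate phase inverts**: `φ_{c̄} (φ_c x) = x`. -/
theorem phaseRot_conj_apply_phaseRot {c : ℂ} (hc : ‖c‖ = 1) (hc' : ‖conj c‖ = 1)
    (x : EuclideanSpace ℝ (n ⊕ n)) : phaseRot (conj c) hc' (phaseRot c hc x) = x := by
  apply cplx_injective
  rw [cplx_phaseRot, cplx_phaseRot, smul_smul, Complex.conj_mul', hc]
  simp

omit [DecidableEq n] in
/-- `‖x‖² = Σ_i ‖(cplx x)_i‖²`. -/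
theorem norm_sq_eq_sum_norm_cplx_sq (x : EuclideanSpace ℝ (n ⊕ n)) : ‖x‖ ^ 2 = ∑ i, ‖cplx x i‖ ^ 2 := by
  rw [← norm_rvec_sq, rvec_cplx]

/-- **The diagonal matrix element of a phase**: `⟪φ_w x, x⟫ = Re(w)·‖x‖²`. -/
theorem inner_phaseRot_self {w : ℂ} (hw : ‖w‖ = 1) (x : EuclideanSpace ℝ (n ⊕ n)) :
    ⟪phaseRot w hw x, x⟫ = w.re * ‖x‖ ^ 2 := by
  rw [real_inner_comm, inner_eq_re_sum_conj_mul, cplx_phaseRot, norm_sq_eq_sum_norm_cplx_sq,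
    Finset.mul_sum]
  have h : ∀ i, conj (cplx x i) * (w • cplx x) i = w * (‖cplx x i‖ ^ 2 : ℝ) := fun i => by
    rw [Pi.smul_apply, smul_eq_mul, ← mul_assoc, mul_comm (conj (cplx x i)) w, mul_assoc,
      Complex.conj_mul', Complex.ofReal_pow]
  simp_rw [h]
  rw [Complex.re_sum]
  refine Finset.sum_congr rfl fun i _ => ?_
  rw [Complex.re_mul_ofReal]

end Phase

/-! ## §2 The trace of a phase and the triangle trace -/

section Trace

/-- **`Σ_i ⟪φ_w b_i, b_i⟫ = (card ι)·Re w`** for every orthonormal basis `b` (each diagonal matrix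
element is `Re w`): the real trace of multiplication by `w` on `ℂ^N ≅ ℝ^{2N}` is `2N·Re w`. -/
theorem sum_inner_phaseRot_orthonormalBasis {ι : Type*} [Fintype ι]
    (b : OrthonormalBasis ι ℝ (EuclideanSpace ℝ (n ⊕ n))) {w : ℂ} (hw : ‖w‖ = 1) :
    ∑ i, ⟪phaseRot w hw (b i), b i⟫ = (Fintype.card ι : ℝ) * w.re := by
  simp_rw [inner_phaseRot_self hw, b.orthonormal.1, one_pow, mul_one]
  rw [Finset.sum_const, Finset.card_univ, nsmul_eq_mul]

/-- **THE TRIANGLE TRACE FOR `U(1)` PHASES**: for unit complex numbers `a, b, c` and every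
orthonormal basis `e` of `ℝ^{2N}`, `Σ_i ⟪φ_a (φ_b e_i), φ_c e_i⟫ = (card ι)·Re(c̄·a·b)`.  With
`U_kn = φ_{λ_kn}`, `U_nm = φ_{λ_nm}`, `U_km = φ_{λ_km}`, `λ_mk = λ̄_km`, this is the term
`Σ_i ⟪U_kn U_nm e_i, U_km e_i⟫ = d·Re(λ_mk λ_kn λ_nm)` of GEN-13's closed form of `ċ₂`:
`d` times the cosine of the flux through the oriented triangle. -/
theorem sum_inner_phaseRot_triangle {ι : Type*} [Fintype ι]
    (e : OrthonormalBasis ι ℝ (EuclideanSpace ℝ (n ⊕ n))) {a b c : ℂ} (ha : ‖a‖ = 1) (hb : ‖b‖ = 1)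
    (hc : ‖c‖ = 1) :
    ∑ i, ⟪phaseRot a ha (phaseRot b hb (e i)), phaseRot c hc (e i)⟫ =
      (Fintype.card ι : ℝ) * (conj c * a * b).re := by
  have hcc : ‖conj c‖ = 1 := by rw [Complex.norm_conj, hc]
  have hca : ‖conj c * a‖ = 1 := by rw [norm_mul, hcc, ha, mul_one]
  have hcab : ‖conj c * a * b‖ = 1 := by rw [norm_mul, hca, hb, mul_one]
  have hpt : ∀ i, ⟪phaseRot a ha (phaseRot b hb (e i)), phaseRot c hc (e i)⟫ =
      ⟪phaseRot (conj c * a * b) hcab (e i), e i⟫ := fun i => by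
    -- apply the isometry `φ_{c̄}` to both arguments
    rw [← (phaseRot (conj c) hcc).inner_map_map, phaseRot_conj_apply_phaseRot hc hcc,
      phaseRot_apply_phaseRot hcc ha hca, phaseRot_apply_phaseRot hca hb hcab]
  simp_rw [hpt]
  exact sum_inner_phaseRot_orthonormalBasis e hcab

/-- The same through the dimension: for the standard-indexed orthonormal basis
`stdOrthonormalBasis ℝ (ℝ^{2N})` the prefactor is `finrank = 2·card n = d`. -/
theorem sum_inner_phaseRot_triangle_std {a b c : ℂ} (ha : ‖a‖ = 1) (hb : ‖b‖ = 1) (hc : ‖c‖ = 1) :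
    ∑ i, ⟪phaseRot a ha (phaseRot b hb (stdOrthonormalBasis ℝ (EuclideanSpace ℝ (n ⊕ n)) i)),
        phaseRot c hc (stdOrthonormalBasis ℝ (EuclideanSpace ℝ (n ⊕ n)) i)⟫ =
      (2 * Fintype.card n : ℝ) * (conj c * a * b).re := by
  rw [sum_inner_phaseRot_triangle _ ha hb hc, Fintype.card_fin, finrank_euclideanSpace,
    Fintype.card_sum]
  push_cast
  ring

end Trace

end Summit.Ventures.LatticeQCDFlow.Exactness

end
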